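import Mathlib
import Summits.ValiantsHypothesis.ValiantsHypothesis.Theorems.NewtonUnitEquationsNewtonTauWeakAutomatonGreedy

/-!
# `NewtonUnitEquationsNewtonTauWeakAutomatonGreedyGen` — general carry automaton: every Newton vertex is a greedy
position

Rung toward `stub_binomialNewtonTauCommon` (crux `NewtonTauWeak`, stmt-ValiantsHypothesis-5904), line
`binomial-normal-form`, lead c4, THEOREM B (carry automaton with carries in `{0, …, C}²`): registered stub
`stub_autoGreedyGen`, the generalisation of `stub_autoGreedy` (file `…NewtonTauWeakAutomatonGreedy.lean`, carries in
`{0,1}²`) to an arbitrary number `C + 1` of carry values per coordinate.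

Setting.  `f : MvPolynomial (Fin 2) ℂ` has all its exponents in the box `[0, 2^n (C+1))²`, and its coefficient ARRAY is
a linear image of a vector configuration `x : E → ℂ^d` on the digit box `E = [0, 2^n)²`: for every final state
`t ∈ {0, …, C}²` and every `P ∈ E`, `coeff_{2^n t + P} f = ℓ_t (x P)` for linear functionals `ℓ_t`.

Claim `stub_autoGreedyGen`: `vert f ≤ (C+1)² · |cshadow E x|`, where `cshadow` (Theorem Q's configuration shadow, file
`…DissociatedUniformGreedyCharts.lean`) is the set of positions which are lex-greedy for some planar direction whose
height is injective on `E`.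

Proof (verbatim the proof of `stub_autoGreedy`, with `{0,1}²` replaced by `{0, …, C}²`).  A vertex `V` of the Newton
polygon is, by `stub_exposedGenericDirection`, the embedding of an exponent `v ∈ supp f` which is the STRICT maximiser
over `supp f` of a height `s ↦ ∑ i, w i * s i`, with `w` chosen so that this height is injective on the finite set `T`
of all exponents `2^n t + Q`, `t ∈ {0, …, C}²`, `Q ∈ E`.  Write `v = 2^n t + P` (`t = v / 2^n < C + 1`,
`P = v % 2^n ∈ E` coordinatewise; `exists_digits_gen`).  Then `P` is greedy for the direction `w`: the height of
`2^n t + Q` is a constant (depending on `t`) plus the planar height `lin w Q = w 0 * Q.1 + w 1 * Q.2`, so (i) `lin w` is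
injective on `E` (injectivity on `T`), and (ii) for every `Q ∈ E` with `lin w P < lin w Q` the exponent `2^n t + Q` is
strictly higher than the strict maximiser `v`, hence not in `supp f`, i.e. `ℓ_t (x Q) = coeff_{2^n t + Q} f = 0`: the
functional `ℓ_t` kills the span of these `x Q` (`AutoGreedyAux.not_mem_span_of_functional`) but
`ℓ_t (x P) = coeff_v f ≠ 0`, so `x P` is not in that span.  Hence `P ∈ cshadow E x` and `V = emb (2^n t + P)`: the
vertex set lies in the image of `{0, …, C}² × cshadow`, of size `(C+1)² · |cshadow|` (`Fintype.card_prod`,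
`Fintype.card_fin`).
[folklore: Theorem Q, "the top survivor is greedy"]
-/

set_option linter.dupNamespace false

noncomputable section

open scoped BigOperators
open MvPolynomial
open Summit.ValiantsHypothesis.ValiantsHypothesis.Theorems.NewtonTauWeak.Negative (vert)
open Summit.ValiantsHypothesis.ValiantsHypothesis.Theorems.NewtonUnitEquationsDissociatedUniform
  (stub_exposedGenericDirection)
open Summit.ValiantsHypothesis.ValiantsHypothesis.Theorems.NewtonUnitEquationsDissociatedUniform.QuasiPoly
  (cshadow gE lin cshadow_finite)

namespace Summit.ValiantsHypothesis.ValiantsHypothesis.Theorems.NewtonTauWeakAutomaton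

namespace AutoGreedyGenAux

open AutoGreedyAux in
/-- **Digits with a bounded carry.**  Every exponent in the box `[0, 2^n (C+1))²` is `2^n t + P` with a final state
`t ∈ {0, …, C}²` and a position `P ∈ [0, 2^n)²` (division with remainder by `2^n`, coordinatewise: `t = v / 2^n`,
`P = v % 2^n`). [folklore] -/
theorem exists_digits_gen (C n : ℕ) (v : Fin 2 →₀ ℕ) (hv0 : v 0 < 2 ^ n * (C + 1)) (hv1 : v 1 < 2 ^ n * (C + 1)) :
    ∃ (t : Fin (C + 1) × Fin (C + 1)) (P : ℕ × ℕ),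
      Finsupp.single 0 (2 ^ n * (t.1 : ℕ) + P.1) + Finsupp.single 1 (2 ^ n * (t.2 : ℕ) + P.2) = v ∧
        P.1 < 2 ^ n ∧ P.2 < 2 ^ n := by
  have hpos : 0 < 2 ^ n := Nat.two_pow_pos n
  have hv0' : v 0 < (C + 1) * 2 ^ n := by rw [mul_comm]; exact hv0
  have hv1' : v 1 < (C + 1) * 2 ^ n := by rw [mul_comm]; exact hv1
  refine ⟨(⟨v 0 / 2 ^ n, (Nat.div_lt_iff_lt_mul hpos).2 hv0'⟩, ⟨v 1 / 2 ^ n, (Nat.div_lt_iff_lt_mul hpos).2 hv1'⟩),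
    (v 0 % 2 ^ n, v 1 % 2 ^ n), ?_, Nat.mod_lt _ hpos, Nat.mod_lt _ hpos⟩
  refine Finsupp.ext (Fin.forall_fin_two.2 ⟨?_, ?_⟩)
  · rw [single_add_single_apply_zero]; exact Nat.div_add_mod _ _
  · rw [single_add_single_apply_one]; exact Nat.div_add_mod _ _

end AutoGreedyGenAux

open AutoGreedyAux AutoGreedyGenAux in
/-- **`stub_autoGreedyGen`** (crux `NewtonTauWeak`, line `binomial-normal-form`, Theorem B, general carry automaton —
top survivors are greedy, abstract form).  If the exponents of `f` lie in `[0, 2^n (C+1))²` and the coefficient array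
of `f` is a linear image `coeff_{2^n t + P} f = ℓ_t (x P)` (`t ∈ {0, …, C}²`, `P ∈ E = [0,2^n)²`) of a vector
configuration `x` on the digit box, then every Newton vertex `2^n t + P` of `f` has `P` lex-greedy for a direction
whose planar height is injective on `E` (`ℓ_t` kills the vectors of all strictly higher positions but not `x P`), so
`vert f ≤ (C+1)² · |cshadow E x|` (`stub_exposedGenericDirection` supplies the strictly exposing, generic direction;
generalises `stub_autoGreedy`, the case `C = 1`). [folklore: Theorem Q, part "top survivor is greedy"] -/
theorem stub_autoGreedyGen {d : ℕ} (C n : ℕ) (E : Finset (ℕ × ℕ))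
    (hE : E = Finset.range (2 ^ n) ×ˢ Finset.range (2 ^ n))
    (f : MvPolynomial (Fin 2) ℂ) (x : ℕ × ℕ → Fin d → ℂ) (ℓ : Fin (C + 1) × Fin (C + 1) → (Fin d → ℂ) →ₗ[ℂ] ℂ)
    (hsupp : ∀ e ∈ f.support, e 0 < 2 ^ n * (C + 1) ∧ e 1 < 2 ^ n * (C + 1))
    (hcoeff : ∀ t : Fin (C + 1) × Fin (C + 1), ∀ P ∈ E,
      coeff (Finsupp.single 0 (2 ^ n * (t.1 : ℕ) + P.1) + Finsupp.single 1 (2 ^ n * (t.2 : ℕ) + P.2)) f = ℓ t (x P)) :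
    vert f ≤ (C + 1) * (C + 1) *
      (Summit.ValiantsHypothesis.ValiantsHypothesis.Theorems.NewtonUnitEquationsDissociatedUniform.QuasiPoly.cshadow
        E x (fun P => ((P.1 : ℕ) : ℝ)) (fun P => ((P.2 : ℕ) : ℝ))).ncard := by
  classical
  -- adapted from NewtonUnitEquationsNewtonTauWeakAutomatonGreedy.lean (`stub_autoGreedy`, carries in `{0,1}²`)
  -- the exponent `2^n t + P`, kept opaque as `g t P`
  obtain ⟨g, hg⟩ : ∃ g : Fin (C + 1) × Fin (C + 1) → ℕ × ℕ → (Fin 2 →₀ ℕ), ∀ t P, g t P =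
      Finsupp.single 0 (2 ^ n * (t.1 : ℕ) + P.1) + Finsupp.single 1 (2 ^ n * (t.2 : ℕ) + P.2) :=
    ⟨_, fun _ _ => rfl⟩
  have hg0 : ∀ t P, g t P 0 = 2 ^ n * (t.1 : ℕ) + P.1 := fun t P => by
    rw [hg, single_add_single_apply_zero]
  have hg1 : ∀ t P, g t P 1 = 2 ^ n * (t.2 : ℕ) + P.2 := fun t P => by
    rw [hg, single_add_single_apply_one]
  -- for a fixed final state the position is determined by the exponent
  have hginj : ∀ t P Q, g t P = g t Q → P = Q := by
    intro t P Q h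
    have h0 := DFunLike.congr_fun h 0
    have h1 := DFunLike.congr_fun h 1
    rw [hg0, hg0, add_right_inj] at h0
    rw [hg1, hg1, add_right_inj] at h1
    exact Prod.ext h0 h1
  -- the height of `2^n t + P` is a constant depending on `t` plus the planar height of `P`
  have hheight : ∀ (w : Fin 2 → ℝ) (t : Fin (C + 1) × Fin (C + 1)) (P : ℕ × ℕ),
      ∑ i, w i * ((g t P i : ℕ) : ℝ) =
      (w 0 * ((2 ^ n * (t.1 : ℕ) : ℕ) : ℝ) + w 1 * ((2 ^ n * (t.2 : ℕ) : ℕ) : ℝ)) +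
        lin (fun P : ℕ × ℕ => ((P.1 : ℕ) : ℝ)) (fun P : ℕ × ℕ => ((P.2 : ℕ) : ℝ)) w P := by
    intro w t P
    simp only [Fin.sum_univ_two, hg0, hg1, lin, Nat.cast_add]
    ring
  have hcoeff' : ∀ t, ∀ P ∈ E, coeff (g t P) f = ℓ t (x P) := fun t P hP => by
    rw [hg]; exact hcoeff t P hP
  -- digits (with a carry in `{0, …, C}`) of a support exponent
  have hdigits : ∀ v ∈ f.support, ∃ t P, g t P = v ∧ P ∈ E := by
    intro v hv
    obtain ⟨t, P, h, hP1, hP2⟩ := exists_digits_gen C n v (hsupp v hv).1 (hsupp v hv).2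
    refine ⟨t, P, by rw [hg]; exact h, ?_⟩
    rw [hE, Finset.mem_product, Finset.mem_range, Finset.mem_range]
    exact ⟨hP1, hP2⟩
  obtain ⟨S, hS⟩ :=
    (cshadow_finite E x (fun P : ℕ × ℕ => ((P.1 : ℕ) : ℝ)) (fun P : ℕ × ℕ => ((P.2 : ℕ) : ℝ))).exists_finset_coe
  -- every vertex is the embedding of `2^n t + P` with `P` in the configuration shadow
  have hsub : Set.extremePoints ℝ (convexHull ℝ ((fun e : Fin 2 →₀ ℕ => fun i : Fin 2 => ((e i : ℕ) : ℝ)) ''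
      (f.support : Set (Fin 2 →₀ ℕ)))) ⊆
      (fun q : (Fin (C + 1) × Fin (C + 1)) × (ℕ × ℕ) => fun i : Fin 2 => ((g q.1 q.2 i : ℕ) : ℝ)) ''
        ((Finset.univ ×ˢ S : Finset ((Fin (C + 1) × Fin (C + 1)) × (ℕ × ℕ))) :
          Set ((Fin (C + 1) × Fin (C + 1)) × (ℕ × ℕ))) := by
    intro V hV
    -- a strictly exposing direction, generic for all exponents `2^n t + Q`, `Q ∈ E`
    obtain ⟨w, v, hv, hVe, hmax, hinjT⟩ := stub_exposedGenericDirection f.support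
      ((Finset.univ ×ˢ E).image fun q : (Fin (C + 1) × Fin (C + 1)) × (ℕ × ℕ) => g q.1 q.2) V hV
    obtain ⟨t, P, hvP, hPE⟩ := hdigits v hv
    have hT : ∀ Q ∈ E, g t Q ∈
        (((Finset.univ ×ˢ E).image fun q : (Fin (C + 1) × Fin (C + 1)) × (ℕ × ℕ) => g q.1 q.2 : Finset _) :
          Set (Fin 2 →₀ ℕ)) := fun Q hQ =>
      Finset.mem_coe.mpr (Finset.mem_image.mpr ⟨(t, Q), Finset.mem_product.mpr ⟨Finset.mem_univ _, hQ⟩, rfl⟩)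
    -- (i) the planar height is injective on `E`
    have hinjE : Set.InjOn (lin (fun P : ℕ × ℕ => ((P.1 : ℕ) : ℝ)) (fun P : ℕ × ℕ => ((P.2 : ℕ) : ℝ)) w) E := by
      intro Q₁ hQ₁ Q₂ hQ₂ heq
      refine hginj t Q₁ Q₂ (hinjT (hT Q₁ hQ₁) (hT Q₂ hQ₂) ?_)
      show ∑ i, w i * ((g t Q₁ i : ℕ) : ℝ) = ∑ i, w i * ((g t Q₂ i : ℕ) : ℝ)
      rw [hheight, hheight, heq]
    -- (ii) `P` is greedy: `ℓ t` kills the strictly higher vectors but not `x P`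
    have hgE : P ∈ gE E x (lin (fun P : ℕ × ℕ => ((P.1 : ℕ) : ℝ)) (fun P : ℕ × ℕ => ((P.2 : ℕ) : ℝ)) w) := by
      refine ⟨hPE, not_mem_span_of_functional (ℓ t) ?_ ?_⟩
      · rintro _ ⟨Q, ⟨hQE, hlt⟩, rfl⟩
        rw [← hcoeff' t Q hQE, ← notMem_support_iff]
        intro hQsupp
        have hgt : ∑ i, w i * ((v i : ℕ) : ℝ) < ∑ i, w i * ((g t Q i : ℕ) : ℝ) := by
          rw [← hvP, hheight, hheight]
          linarith
        by_cases hne : g t Q = v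
        · rw [hne] at hgt
          exact lt_irrefl _ hgt
        · exact lt_asymm hgt (hmax _ hQsupp hne)
      · rw [← hcoeff' t P hPE, hvP]
        exact mem_support_iff.mp hv
    have hPS : P ∈ S := by
      rw [← Finset.mem_coe, hS]
      exact ⟨w, hinjE, hgE⟩
    refine ⟨(t, P), Finset.mem_coe.mpr (Finset.mem_product.mpr ⟨Finset.mem_univ _, hPS⟩), ?_⟩
    show (fun i : Fin 2 => ((g t P i : ℕ) : ℝ)) = V
    rw [hvP]
    exact hVe
  calc vert f = (Set.extremePoints ℝ (convexHull ℝ ((fun e : Fin 2 →₀ ℕ => fun i : Fin 2 => ((e i : ℕ) : ℝ)) ''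
      (f.support : Set (Fin 2 →₀ ℕ))))).ncard := rfl
    _ ≤ ((fun q : (Fin (C + 1) × Fin (C + 1)) × (ℕ × ℕ) => fun i : Fin 2 => ((g q.1 q.2 i : ℕ) : ℝ)) ''
        ((Finset.univ ×ˢ S : Finset ((Fin (C + 1) × Fin (C + 1)) × (ℕ × ℕ))) :
          Set ((Fin (C + 1) × Fin (C + 1)) × (ℕ × ℕ)))).ncard :=
        Set.ncard_le_ncard hsub ((Finset.finite_toSet _).image _)
    _ ≤ ((Finset.univ ×ˢ S : Finset ((Fin (C + 1) × Fin (C + 1)) × (ℕ × ℕ))) :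
          Set ((Fin (C + 1) × Fin (C + 1)) × (ℕ × ℕ))).ncard :=
        Set.ncard_image_le (Finset.finite_toSet _)
    _ = (C + 1) * (C + 1) *
          (cshadow E x (fun P : ℕ × ℕ => ((P.1 : ℕ) : ℝ)) (fun P : ℕ × ℕ => ((P.2 : ℕ) : ℝ))).ncard := by
        rw [Set.ncard_coe_finset, Finset.card_product, Finset.card_univ, ← hS, Set.ncard_coe_finset,
          Fintype.card_prod, Fintype.card_fin]

end Summit.ValiantsHypothesis.ValiantsHypothesis.Theorems.NewtonTauWeakAutomaton

end
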